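import Mathlib
import HarnessLib
import Summits.HubbardSuperconductivity.HubbardSuperconductivity.Theorems.KLProgrammeKLRegimeWickCumulantPartition

/-!
# Route `KLProgramme` — ENGINE child (E2-v9): the WICK CUMULANT TREE FORMULA
# (E2-WICK-ROADMAP §5 (i), third part; cell gate-hubbard-kl, seat p1 g8)

The partition formula `wickCumulant_partition` (p491109) resums the soft smearing of the step's cumulant block by block; for BOUNDS one
wants the Brydges–Battle–Federbush TREE form in which the `C`-connectedness is carried by a tree of `C`-lines and no factorial appears.
This file proves it, on the replica labels `Fin n × Γ` (`cl = Prod.fst`): with `M′ a = copy_a(e^{−Δ_{D+C}} w_a)` (the step's vertices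
`𝒱 = e^{−Δ_{D+C}} 𝒲` in replica `a`), for `v ∈ W`,

  `e^{Δ_{allCov D}} ( 𝓔ᵀ_C(M′; W) ) = treeOp_{offCov C}(v, W) ( e^{Δ_{offCov D}} ∏_{a∈W} copy_a(w_a) )`      (`wickCumulant_treeOp`),

i.e. the soft smearing of the `C`-truncated expectation of the vertices is the BBF tree operator of the INTER-replica `C`-lines
(`Σ_{trees} ∏_{ℓ∈T} Δ_{C|ℓ} ∫ w_T(t) e^{Δ_{t∘offCov C}} dt`) applied to the inter-replica-`D`-smeared product of the WICK vertices `w_a`: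
no line of either kind joins a replica to itself.  Ingredients: (§1) an abstract Battle–Federbush lemma — for a VALID script the
diagonal pairs `{a,a}` are never lines and carry interpolation weight `1`, so `treeFactor D s = treeFactor D^{off} s · exp(Σ_{a∈Q_s} D_{aa})`
(`treeFactor_eq_offDiag_mul_exp`, `D^{off} ℓ = [ℓ off-diagonal] D ℓ`); (§2) on replicas the diagonal pair Laplacians of `allCov C` are the block Laplacians `Δ_{blkCov C a a}` and the
off-diagonal ones are those of `offCov C`; (§3) the operator identity `treeOp_{allCov C}(v,W) = treeOp_{offCov C}(v,W) ∘ e^{Δ_{Σ_{a∈W} blkCov C a a}}`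
(`coe_treeOp_allCov_eq`); (§4) assembly with `ursellOf_convMoment_eq_treeOp`, the commutation of the Laplacian algebra with every `e^{Δ_E}`, and
the replica-wise action of the diagonal blocks (`gaussConv_diagCov_prod_replicaCopyEven_wick`, p489692).  Proved; no definitions; nothing about the model is asserted.
-/

noncomputable section

namespace Summit.HubbardSuperconductivity.HubbardSuperconductivity.Theorems.KLRegimeWick

set_option linter.dupNamespace false -- summit = problem name (single-conjunct summit), D-0017

open Literature.MathematicalPhysics.QuantumLattice GrassmannAlgebra Finset Matrix MvPolynomial
open Literature.Probability.LatticeModels Literature.Probability.LatticeModels.BattleFederbush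

/-! ## §1 Abstract: diagonal pairs factor out of the tree factor of a valid script -/

section Abstract

variable {ι : Type*} [Fintype ι] [DecidableEq ι] {A : Type*} [CommRing A] [Algebra ℚ A] {root : ι}

omit [Fintype ι] [DecidableEq ι] in
/-- The lines of a VALID script are off-diagonal pairs. -/
theorem lines_not_isDiag : ∀ {k : ℕ} (s : Script root k), s.Valid → ∀ ℓ ∈ s.lines, ¬ ℓ.IsDiag
  | _, Script.nil, _ => by simp [Script.lines]
  | _, Script.snoc s i z, hs => by
    intro ℓ hℓ
    rw [Script.lines, List.mem_append, List.mem_singleton] at hℓ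
    rcases hℓ with hℓ | rfl
    · exact lines_not_isDiag s ((Script.valid_snoc_iff s i z).1 hs).1 ℓ hℓ
    · rw [Sym2.mk_isDiag_iff]
      exact ((Script.valid_snoc_iff s i z).1 hs).2 i

omit [Fintype ι] in
/-- A diagonal pair crosses no boundary: `crossB Q {a,a} = false`. -/
theorem crossB_diag (Q : Finset ι) (a : ι) : crossB Q s(a, a) = false := by
  rw [crossB_mk, Bool.xor_self]

omit [Fintype ι] [Algebra ℚ A] in
/-- Hence its interpolation weight in any script is `1`. -/
theorem livePt_diag {k : ℕ} (s : Script root k) (a : ι) : Script.livePt A s s(a, a) = 1 := by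
  have h0 : s.cutExp k s(a, a) = 0 := by
    unfold Script.cutExp
    refine Finset.sum_eq_zero fun m _ => ?_
    rw [if_neg]
    rintro ⟨-, h⟩
    rw [crossB_diag] at h
    exact Bool.false_ne_true h
  rw [Script.livePt, h0]
  rfl

omit [Fintype ι] [Algebra ℚ A] in
/-- The family with the diagonal pairs switched off, `ℓ ↦ [ℓ off-diagonal] D ℓ`, is nilpotent where `D` is. -/
theorem isNilpotent_offDiag {D : Sym2 ι → A} (hD : ∀ ℓ, IsNilpotent (D ℓ)) (ℓ : Sym2 ι) :
    IsNilpotent ((fun ℓ : Sym2 ι => if ℓ.IsDiag then 0 else D ℓ) ℓ) := by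
  dsimp only
  split_ifs
  · exact IsNilpotent.zero
  · exact hD ℓ

omit [Fintype ι] in
/-- The diagonal pairs inside `Q` are the `{a,a}`, `a ∈ Q`. -/
theorem filter_inside_isDiag_eq_image [Fintype (Sym2 ι)] (Q : Finset ι) :
    (Finset.univ.filter fun ℓ : Sym2 ι => insideB Q ℓ = true ∧ ℓ.IsDiag) = Q.image fun a => s(a, a) := by
  ext ℓ
  simp only [Finset.mem_filter, Finset.mem_univ, true_and, Finset.mem_image]
  induction ℓ using Sym2.ind with
  | h x y =>
    rw [insideB_eq_true_iff, Sym2.mk_isDiag_iff]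
    constructor
    · rintro ⟨hin, rfl⟩
      exact ⟨x, hin x (Sym2.mem_mk_left _ _), rfl⟩
    · rintro ⟨a, ha, h⟩
      have hx : a = x ∧ a = y := by
        rcases Sym2.eq_iff.1 h with ⟨h1, h2⟩ | ⟨h1, h2⟩
        · exact ⟨h1, h2⟩
        · exact ⟨h2, h1⟩
      obtain ⟨rfl, rfl⟩ := hx
      refine ⟨fun w hw => ?_, rfl⟩
      rcases Sym2.mem_iff.1 hw with rfl | rfl <;> exact ha

omit [Algebra ℚ A] in
/-- **The inner form splits off its diagonal part**: `innerForm D s = innerForm ([off-diagonal]·D) s + C (Σ_{a∈Q_s} D_{aa})`. -/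
theorem innerForm_eq_offDiag_add {k : ℕ} (D : Sym2 ι → A) (s : Script root k) :
    Script.innerForm D s = Script.innerForm (fun ℓ : Sym2 ι => if ℓ.IsDiag then 0 else D ℓ) s +
      C (∑ a ∈ Finset.univ.image s.y, D s(a, a)) := by
  set Q := Finset.univ.image s.y with hQ
  have hpt : ∀ ℓ ∈ Finset.univ.filter (fun ℓ : Sym2 ι => insideB Q ℓ = true),
      Script.livePt A s ℓ * C (D ℓ) =
        Script.livePt A s ℓ * C ((fun ℓ : Sym2 ι => if ℓ.IsDiag then 0 else D ℓ) ℓ) + if ℓ.IsDiag then C (D ℓ) else 0 := by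
    intro ℓ _
    dsimp only
    by_cases hd : ℓ.IsDiag
    · rw [if_pos hd, if_pos hd, map_zero, mul_zero, zero_add]
      induction ℓ using Sym2.ind with
      | h x y =>
        rw [Sym2.mk_isDiag_iff] at hd
        subst hd
        rw [livePt_diag, one_mul]
    · rw [if_neg hd, if_neg hd, add_zero]
  rw [Script.innerForm, Script.innerForm, Finset.sum_congr rfl hpt, Finset.sum_add_distrib, ← Finset.sum_filter, Finset.filter_filter,
    filter_inside_isDiag_eq_image, Finset.sum_image fun a _ b _ h => ?_, map_sum]
  rcases Sym2.eq_iff.1 h with ⟨h1, -⟩ | ⟨h1, -⟩ <;> exact h1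

/-- **Diagonal pairs factor out of the tree factor of a valid script**:
`treeFactor D s = treeFactor ([off-diagonal]·D) s · exp (Σ_{a∈Q_s} D_{aa})` (the lines are off-diagonal, the diagonal weights are `1`). -/
theorem treeFactor_eq_offDiag_mul_exp {k : ℕ} {D : Sym2 ι → A} (hD : ∀ ℓ, IsNilpotent (D ℓ)) (s : Script root k) (hs : s.Valid) :
    Script.treeFactor D s = Script.treeFactor (fun ℓ : Sym2 ι => if ℓ.IsDiag then 0 else D ℓ) s *
      IsNilpotent.exp (∑ a ∈ Finset.univ.image s.y, D s(a, a)) := by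
  have hlines : s.lines.map D = s.lines.map (fun ℓ : Sym2 ι => if ℓ.IsDiag then 0 else D ℓ) :=
    List.map_congr_left fun ℓ hℓ => by rw [if_neg (lines_not_isDiag s hs ℓ hℓ)]
  have hnil : IsNilpotent (∑ a ∈ Finset.univ.image s.y, D s(a, a)) :=
    Commute.isNilpotent_sum (fun a _ => hD _) fun _ _ _ _ => Commute.all _ _
  have hexp : IsNilpotent.exp (Script.innerForm (fun ℓ : Sym2 ι => if ℓ.IsDiag then 0 else D ℓ) s +
        C (∑ a ∈ Finset.univ.image s.y, D s(a, a))) =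
      IsNilpotent.exp (Script.innerForm (fun ℓ : Sym2 ι => if ℓ.IsDiag then 0 else D ℓ) s) *
        C (IsNilpotent.exp (∑ a ∈ Finset.univ.image s.y, D s(a, a))) := by
    rw [IsNilpotent.exp_add_of_commute (Commute.all _ _) (Script.isNilpotent_innerForm (isNilpotent_offDiag hD) s) (hnil.map C),
      hnil.map_exp C]
  rw [Script.treeFactor_eq_prod_mul, Script.treeFactor_eq_prod_mul, hlines, innerForm_eq_offDiag_add D s, hexp, ← mul_assoc,
    Script.cubeIntegral_mul_C, mul_assoc]

end Abstract

/-! ## §2 Generic: the Laplacian algebras commute with every Gaussian convolution -/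

section Commute

variable (R : Type*) [CommRing R] [Algebra ℚ R] {Γ' : Type*} [Fintype Γ'] [DecidableEq Γ']
variable {ι ι' : Type*} [DecidableEq ι] [DecidableEq ι'] [Fintype ι']

omit [DecidableEq Γ'] [Fintype ι'] in
/-- Elements of two Laplacian algebras (any covariances, any cluster maps) commute. -/
theorem commute_of_mem_laplacianAlgebra {E E' : Matrix Γ' Γ' R} {cl : Γ' → ι} {cl' : Γ' → ι'}
    {T T' : Module.End R (GrassmannAlgebra R Γ')} (hT : T ∈ laplacianAlgebra R E cl) (hT' : T' ∈ laplacianAlgebra R E' cl') :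
    Commute T T' := by
  refine Algebra.commute_of_mem_adjoin_of_forall_mem_commute hT' ?_
  rintro _ ⟨ℓ', -, rfl⟩
  refine (Algebra.commute_of_mem_adjoin_of_forall_mem_commute hT ?_).symm
  rintro _ ⟨ℓ, -, rfl⟩
  exact commute_grassmannLaplacian R _ _

omit [DecidableEq Γ'] in
/-- `e^{Δ_{E'}}` lies in the Laplacian algebra of `E'`. -/
theorem gaussConv_mem_laplacianAlgebra (E' : Matrix Γ' Γ' R) (cl' : Γ' → ι') : gaussConv R E' ∈ laplacianAlgebra R E' cl' := by
  rw [← coe_exp_sum_pairLap R E' cl']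
  exact SetLike.coe_mem _

omit [DecidableEq Γ'] in
/-- **An element of a Laplacian algebra passes every Gaussian convolution**: `T (e^{Δ_{E'}} x) = e^{Δ_{E'}} (T x)`. -/
theorem laplacianAlgebra_apply_gaussConv {E : Matrix Γ' Γ' R} {cl : Γ' → ι} {T : Module.End R (GrassmannAlgebra R Γ')}
    (hT : T ∈ laplacianAlgebra R E cl) (E' : Matrix Γ' Γ' R) (x : GrassmannAlgebra R Γ') :
    T (gaussConv R E' x) = gaussConv R E' (T x) := by
  classical
  have h := commute_of_mem_laplacianAlgebra R hT (gaussConv_mem_laplacianAlgebra R E' (fun X : Γ' => (0 : Fin 1)))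
  simpa only [Module.End.mul_apply] using LinearMap.congr_fun h.eq x

omit [DecidableEq Γ'] [DecidableEq ι] [DecidableEq ι'] [Fintype ι'] in
/-- `Δ` of a finite sum of covariances. -/
theorem grassmannLaplacian_finset_sum {α : Type*} (S : Finset α) (E : α → Matrix Γ' Γ' R) :
    grassmannLaplacian R (∑ a ∈ S, E a) = ∑ a ∈ S, grassmannLaplacian R (E a) := by
  classical
  induction S using Finset.induction_on with
  | empty => rw [Finset.sum_empty, Finset.sum_empty, grassmannLaplacian_zero]
  | insert a S ha ih => rw [Finset.sum_insert ha, Finset.sum_insert ha, grassmannLaplacian_add, ih]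

end Commute

/-! ## §3 Replicas: diagonal and off-diagonal pair Laplacians of `allCov C` -/

section Replica

variable (R : Type*) [CommRing R] [Algebra ℚ R] {Γ : Type*} [Fintype Γ] [DecidableEq Γ] {n : ℕ}

omit [Algebra ℚ R] [Fintype Γ] [DecidableEq Γ] in
/-- The diagonal pair type `{a,a}` of the replica-blind covariance is the diagonal block `blkCov C a a`. -/
theorem typeRestrict_allCov_diag (C : Matrix Γ Γ R) (a : Fin n) :
    typeRestrict (allCov R (n := n) C) (Prod.fst : Fin n × Γ → Fin n) s(a, a) = blkCov R C a a := by
  ext p q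
  simp only [typeRestrict_apply, allCov, blkCov, Matrix.of_apply]
  by_cases h : p.1 = a ∧ q.1 = a
  · rw [if_pos h, if_pos (by rw [h.1, h.2])]
  · rw [if_neg h, if_neg (fun hh => h ?_)]
    rcases Sym2.eq_iff.1 hh with ⟨h1, h2⟩ | ⟨h1, h2⟩
    · exact ⟨h1, h2⟩
    · exact ⟨h1, h2⟩

omit [Algebra ℚ R] [Fintype Γ] [DecidableEq Γ] in
/-- Off the diagonal the pair types of `allCov C` and `offCov C` agree. -/
theorem typeRestrict_allCov_of_not_isDiag (C : Matrix Γ Γ R) {ℓ : Sym2 (Fin n)} (hℓ : ¬ ℓ.IsDiag) :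
    typeRestrict (allCov R (n := n) C) (Prod.fst : Fin n × Γ → Fin n) ℓ = typeRestrict (offCov R C) Prod.fst ℓ := by
  ext p q
  simp only [typeRestrict_apply, allCov, offCov, Matrix.of_apply]
  by_cases h : s(p.1, q.1) = ℓ
  · rw [if_pos h, if_pos h, if_neg]
    intro hpq
    apply hℓ
    rw [← h, Sym2.mk_isDiag_iff]
    exact hpq
  · rw [if_neg h, if_neg h]

omit [Algebra ℚ R] [Fintype Γ] [DecidableEq Γ] in
/-- `offCov C` has no diagonal pair types. -/
theorem typeRestrict_offCov_diag (C : Matrix Γ Γ R) (a : Fin n) :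
    typeRestrict (offCov R (n := n) C) (Prod.fst : Fin n × Γ → Fin n) s(a, a) = 0 := by
  ext p q
  simp only [typeRestrict_apply, offCov, Matrix.of_apply, Matrix.zero_apply]
  by_cases h : s(p.1, q.1) = s(a, a)
  · rw [if_pos h, if_pos]
    rcases Sym2.eq_iff.1 h with ⟨h1, h2⟩ | ⟨h1, h2⟩
    · rw [h1, h2]
    · rw [h1, h2]
  · rw [if_neg h]

omit [DecidableEq Γ] in
/-- **The diagonal pair Laplacian of `allCov C` at replica `a` is `Δ_{blkCov C a a}`.** -/
theorem pairLaplacian_allCov_diag (C : Matrix Γ Γ R) (a : Fin n) :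
    pairLaplacian R (allCov R (n := n) C) (Prod.fst : Fin n × Γ → Fin n) s(a, a) = grassmannLaplacian R (blkCov R C a a) := by
  rw [pairLaplacian, typeRestrict_allCov_diag]

omit [DecidableEq Γ] in
/-- **The pair Laplacians of `offCov C` are those of `allCov C` with the diagonal switched off.** -/
theorem pairLaplacian_offCov_eq (C : Matrix Γ Γ R) (ℓ : Sym2 (Fin n)) :
    pairLaplacian R (offCov R (n := n) C) (Prod.fst : Fin n × Γ → Fin n) ℓ =
      if ℓ.IsDiag then 0 else pairLaplacian R (allCov R C) Prod.fst ℓ := by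
  split_ifs with h
  · induction ℓ using Sym2.ind with
    | h x y =>
      rw [Sym2.mk_isDiag_iff] at h
      subst h
      rw [pairLaplacian, typeRestrict_offCov_diag, grassmannLaplacian_zero]
  · rw [pairLaplacian, pairLaplacian, typeRestrict_allCov_of_not_isDiag R C h]

omit [Algebra ℚ R] [Fintype Γ] [DecidableEq Γ] in
/-- The diagonal blocks of the replicas in `W`: `inCov fst W (diagCov C) = Σ_{a∈W} blkCov C a a`. -/
theorem inCov_diagCov_eq_sum (C : Matrix Γ Γ R) (W : Finset (Fin n)) :
    inCov R (Prod.fst : Fin n × Γ → Fin n) (↑W : Set (Fin n)) (diagCov R C) = ∑ a ∈ W, blkCov R C a a := by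
  ext p q
  simp only [inCov, diagCov, blkCov, Matrix.of_apply, Matrix.sum_apply, Finset.mem_coe]
  by_cases hpq : p.1 = q.1
  · rw [if_pos hpq]  -- inner
    by_cases hp : p.1 ∈ W
    · rw [if_pos ⟨hp, hpq ▸ hp⟩, Finset.sum_eq_single p.1 (fun a _ ha => by rw [if_neg (fun hh => ha hh.1.symm)])
        (fun h => absurd hp h), if_pos ⟨rfl, hpq.symm⟩]
    · rw [if_neg (fun h => hp h.1)]
      refine (Finset.sum_eq_zero fun a ha => ?_).symm
      rw [if_neg]
      rintro ⟨h1, -⟩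
      rw [h1] at hp
      exact hp ha
  · rw [if_neg hpq, ite_self]
    exact (Finset.sum_eq_zero fun a _ => by rw [if_neg (fun hh => hpq (hh.1.trans hh.2.symm))]).symm

omit [DecidableEq Γ] in
/-- The Laplacian algebra of `offCov C` sits inside that of `allCov C`. -/
theorem laplacianAlgebra_offCov_le (C : Matrix Γ Γ R) :
    laplacianAlgebra R (offCov R (n := n) C) (Prod.fst : Fin n × Γ → Fin n) ≤ laplacianAlgebra R (allCov R C) Prod.fst := by
  refine Algebra.adjoin_le ?_
  rintro _ ⟨ℓ, -, rfl⟩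
  rw [SetLike.mem_coe, pairLaplacian_offCov_eq]
  split_ifs
  · exact zero_mem _
  · exact pairLaplacian_mem_lapAdjoin R _ _ (Set.mem_univ ℓ)

omit [DecidableEq Γ] in
/-- **The tree operator of `allCov C` factors**: in the Laplacian algebra of `allCov C`,
`treeOp_{allCov C}(v, W) = treeOp_{offCov C}(v, W) · exp (Σ_{a∈W} Δ_{allCov C|{a,a}})` (valid scripts have off-diagonal lines and
diagonal weights `1`, `treeFactor_eq_offDiag_mul_exp`). -/
theorem treeOp_allCov_eq (C : Matrix Γ Γ R) (v : Fin n) (W : Finset (Fin n)) :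
    treeOp R (allCov R (n := n) C) (Prod.fst : Fin n × Γ → Fin n) v W =
      Subalgebra.inclusion (laplacianAlgebra_offCov_le R C) (treeOp R (offCov R C) Prod.fst v W) *
        IsNilpotent.exp (∑ a ∈ W, pairLap R (allCov R C) Prod.fst s(a, a)) := by
  set φ := Subalgebra.inclusion (laplacianAlgebra_offCov_le R (n := n) C) with hφ
  have hDall : ∀ ℓ, IsNilpotent (pairLap R (allCov R (n := n) C) (Prod.fst : Fin n × Γ → Fin n) ℓ) := isNilpotent_pairLap R _ _
  have hDoff : ∀ ℓ, IsNilpotent (pairLap R (offCov R (n := n) C) (Prod.fst : Fin n × Γ → Fin n) ℓ) := isNilpotent_pairLap R _ _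
  have hφD : ⇑(φ : laplacianAlgebra R (offCov R (n := n) C) (Prod.fst : Fin n × Γ → Fin n) →+*
        laplacianAlgebra R (allCov R (n := n) C) (Prod.fst : Fin n × Γ → Fin n)) ∘ pairLap R (offCov R C) Prod.fst =
      fun ℓ : Sym2 (Fin n) => if ℓ.IsDiag then 0 else pairLap R (allCov R C) Prod.fst ℓ := by
    funext ℓ
    refine Subtype.ext ?_
    change pairLaplacian R (offCov R C) Prod.fst ℓ =
      ((if ℓ.IsDiag then 0 else pairLap R (allCov R (n := n) C) (Prod.fst : Fin n × Γ → Fin n) ℓ :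
        laplacianAlgebra R (allCov R (n := n) C) (Prod.fst : Fin n × Γ → Fin n)) : Module.End R (GrassmannAlgebra R (Fin n × Γ)))
    rw [pairLaplacian_offCov_eq]
    split_ifs <;> rfl
  rw [treeOp, treeOp, map_sum, Finset.sum_mul]
  refine Finset.sum_congr rfl fun k _ => ?_
  rw [map_sum, Finset.sum_mul]
  refine Finset.sum_congr rfl fun s _ => ?_
  by_cases hs : s.Valid ∧ Finset.univ.image s.y = W
  · have hmap := map_treeFactor (φ : laplacianAlgebra R (offCov R (n := n) C) (Prod.fst : Fin n × Γ → Fin n) →+*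
        laplacianAlgebra R (allCov R (n := n) C) (Prod.fst : Fin n × Γ → Fin n)) (pairLap R (offCov R C) Prod.fst) hDoff s
    rw [hφD, RingHom.coe_coe] at hmap
    rw [if_pos hs, if_pos hs, hmap, treeFactor_eq_offDiag_mul_exp hDall s hs.1, hs.2]
  · rw [if_neg hs, if_neg hs, map_zero, zero_mul]

omit [DecidableEq Γ] in
/-- **The same at the level of endomorphisms**: `treeOp_{allCov C}(v,W) x = treeOp_{offCov C}(v,W) (e^{Δ_{Σ_{a∈W} blkCov C a a}} x)`. -/
theorem coe_treeOp_allCov_apply (C : Matrix Γ Γ R) (v : Fin n) (W : Finset (Fin n)) (x : GrassmannAlgebra R (Fin n × Γ)) :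
    ((treeOp R (allCov R (n := n) C) (Prod.fst : Fin n × Γ → Fin n) v W : laplacianAlgebra R (allCov R (n := n) C) Prod.fst) :
        Module.End R (GrassmannAlgebra R (Fin n × Γ))) x =
      ((treeOp R (offCov R (n := n) C) (Prod.fst : Fin n × Γ → Fin n) v W : laplacianAlgebra R (offCov R (n := n) C) Prod.fst) :
          Module.End R (GrassmannAlgebra R (Fin n × Γ))) (gaussConv R (∑ a ∈ W, blkCov R C a a) x) := by
  have hnil : IsNilpotent (∑ a ∈ W, pairLap R (allCov R (n := n) C) (Prod.fst : Fin n × Γ → Fin n) s(a, a)) :=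
    Commute.isNilpotent_sum (fun a _ => isNilpotent_pairLap R _ _ _) fun _ _ _ _ => Commute.all _ _
  have hsum : ((∑ a ∈ W, pairLap R (allCov R (n := n) C) (Prod.fst : Fin n × Γ → Fin n) s(a, a) :
      laplacianAlgebra R (allCov R (n := n) C) Prod.fst) : Module.End R (GrassmannAlgebra R (Fin n × Γ))) =
      grassmannLaplacian R (∑ a ∈ W, blkCov R C a a) := by
    rw [AddSubmonoidClass.coe_finsetSum, grassmannLaplacian_finset_sum]
    simp only [coe_pairLap, pairLaplacian_allCov_diag]
  rw [treeOp_allCov_eq, Subalgebra.coe_mul, Module.End.mul_apply, Subalgebra.coe_inclusion, coe_exp R _ _ hnil, hsum, ← gaussConv_def]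

/-! ## §4 The Wick cumulant tree formula -/

/-- **`wickCumulant_treeOp` — the Wick cumulant TREE formula.**  With `M′ a = copy_a(e^{−Δ_{D+C}} w_a)` (the step's vertices in replica `a`)
and `v ∈ W`:  `e^{Δ_{allCov D}}(ursellOf (convMoment (allCov C) M′) W) = treeOp_{offCov C}(v, W) (e^{Δ_{offCov D}} ∏_{a∈W} copy_a(w_a))` —
the soft smearing of the `C`-truncated expectation is the BBF tree operator of the INTER-replica `C`-lines applied to the
inter-replica-`D`-smeared product of the Wick vertices; no self-lines of either kind. -/
theorem wickCumulant_treeOp (C D : Matrix Γ Γ R) (w : Fin n → evenPart R Γ) (W : Finset (Fin n)) {v : Fin n} (hv : v ∈ W) :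
    gaussConv R (allCov R D)
        ((ursellOf (convMoment R (allCov R C) (fun a => replicaCopyEven R a ⟨gaussConv R (-(D + C)) (w a), gaussConv_neg_mem_evenPart R _ (w a)⟩)) W :
          evenPart R (Fin n × Γ)) : GrassmannAlgebra R (Fin n × Γ)) =
      ((treeOp R (offCov R (n := n) C) (Prod.fst : Fin n × Γ → Fin n) v W : laplacianAlgebra R (offCov R (n := n) C) Prod.fst) :
          Module.End R (GrassmannAlgebra R (Fin n × Γ)))
        (gaussConv R (offCov R D) ((∏ a ∈ W, replicaCopyEven R a (w a) : evenPart R (Fin n × Γ)) : GrassmannAlgebra R (Fin n × Γ))) := by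
  -- the vertices, `C`-Wick-ordered and then `D`-Wick-ordered
  have hM' : (fun a => replicaCopyEven R a ⟨gaussConv R (-(D + C)) (w a), gaussConv_neg_mem_evenPart R _ (w a)⟩) =
      fun a => replicaCopyEven R a ⟨gaussConv R (-D)
          ((⟨gaussConv R (-C) (w a), gaussConv_neg_mem_evenPart R C (w a)⟩ : evenPart R Γ) : GrassmannAlgebra R Γ),
        gaussConv_neg_mem_evenPart R D (⟨gaussConv R (-C) (w a), gaussConv_neg_mem_evenPart R C (w a)⟩ : evenPart R Γ)⟩ := by
    funext a
    congr 1
    exact Subtype.ext (by dsimp only; rw [neg_add, gaussConv_add_apply])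
  have hy : gaussConv R (offCov R D) ((∏ a ∈ W, replicaCopyEven R a
      (⟨gaussConv R (-C) (w a), gaussConv_neg_mem_evenPart R C (w a)⟩ : evenPart R Γ) : evenPart R (Fin n × Γ)) :
        GrassmannAlgebra R (Fin n × Γ)) ∈ fieldSubalgebra R ((Prod.fst : Fin n × Γ → Fin n) ⁻¹' (↑W : Set (Fin n))) :=
    gaussConv_mem_fieldSubalgebra R _ (coe_prod_mem_fieldSubalgebra_preimage R (Prod.fst : Fin n × Γ → Fin n)
      (coe_replicaCopyEven_mem_cluster R (fun a => (⟨gaussConv R (-C) (w a), gaussConv_neg_mem_evenPart R C (w a)⟩ : evenPart R Γ))) W)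
  have hcomm : ∀ y : GrassmannAlgebra R (Fin n × Γ), gaussConv R (diagCov R C) (gaussConv R (offCov R D) y) =
      gaussConv R (offCov R D) (gaussConv R (diagCov R C) y) := fun y => by
    rw [← gaussConv_add_apply, add_comm, gaussConv_add_apply]
  rw [hM', ursellOf_convMoment_eq_treeOp R (allCov R C) Prod.fst (coe_replicaCopyEven_mem_cluster R _) W hv, coe_onEven_apply,
    ← laplacianAlgebra_apply_gaussConv R (SetLike.coe_mem _) (allCov R D)]
  -- `e^{Δ_{allCov D}} = e^{Δ_{offCov D}} e^{Δ_{diagCov D}}`, the diagonal un-doing the `D`-Wick-ordering replica by replica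
  rw [allCov_eq_diag_add_off R D, add_comm (diagCov R D), gaussConv_add_apply, gaussConv_diagCov_prod_replicaCopyEven_wick R D _ W]
  -- the tree operator of `allCov C` = that of `offCov C` after the diagonal `C`-blocks of `W`, which un-do the `C`-Wick-ordering
  rw [coe_treeOp_allCov_apply, ← inCov_diagCov_eq_sum,
    gaussConv_inCov_eq_of_mem R (Prod.fst : Fin n × Γ → Fin n) (↑W : Set (Fin n)) (diagCov R C) hy, hcomm,
    gaussConv_diagCov_prod_replicaCopyEven_wick R C w W]

end Replica

end Summit.HubbardSuperconductivity.HubbardSuperconductivity.Theorems.KLRegimeWick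

end
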